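import Summits.PneNP.PneNP.Theorems.ChebyshevTracialDesignCrossingPlaneByType
import Summits.PneNP.PneNP.Theorems.ChebyshevTracialDesignBlockStatisticPricing
import HarnessLib

/-!
# Cell pnp-psdrank, route `ChebyshevTracialDesign`: THE UNTILTED H-SYMMETRIC MASK `ψ(|U∩H|)` AT `e^{−a′D}` PRECISION, PER
# NON-ALIGNED MATCHING — brick 128a (crux `TracialDecayExp20`, stmt-PneNP-19878)

Brick 128a (prover g25; MEMO-28 §4 (a)). Brick 117 (`abs_designValue_blockStat_add_newton_le`) prices the plain block statistic
`g(U) = ψ(|U ∩ H|)` per matching: `| |PM|·Σ_U W(U,M)ψ + N^odd_D φ_M(0) | ≤ B_v·C((T−1)/2,D+1)·G·ρ^{D+1}·X_{D+1}`; brick 118c turned this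
into `−E_{Shell_1}[ψ] + O(G/n)`. With brick 121's criterion (`shellProfile_newton_eval_zero_ge`: `N^odd_D φ_M(0) ≥ −2^{D+1}G·(tail mass
outside a relatively level-smooth window)`), lit g34's Hoeffding tail for the shell measure (`ShellLawTail.sum_sdiff_sum_levels_shellLaw_le`),
brick 124's [BULK] discharge (Literature `relSmooth_of_hyps` ∘ `shellLaw_one_window_lower` ∘ `bulk_numerics`) and brick 125's type discharge
of the smoothness number (`smoothnessFamily_le_of_type` at `k = D+1`, `e = 0`) the untilted mask is priced at `e^{−a′D}` precision:

* §1 **`blockMask_value_le_of_relSmooth_window`** (brick 117 ∘ brick 121 ∘ ShellLawTail): for `0 ≤ ψ ≤ G`, `ε ≥ 0`, relative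
  level-smoothness on the window `|x − t|H|/n| < ε`, and the order-`(D+1)` smoothness number `X`:
  `|PM|·Σ_U W(U,M)·ψ(|U∩H|) ≤ B_v·C((T−1)/2,D+1)·G·ρ^{D+1}·X + 2^{D+1}·G·(D+1)·2(n/2+1)³·e^{−ε²/|H|}`.
* §2 **`blockMask_value_le_of_type`** — [BULK] and `X` DISCHARGED: for every `β > 0`, `K ≥ 0` there is `n₀` such that for `n ≥ n₀`,
  every balanced exact design (`t = t₁+2(D+1)+2`, `n ≤ 4t`, `2D+1 ≤ T`, `1 ≤ D`, `D⁴ ≤ n`), every `M, H` with brick 124's margins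
  `βn/2 + 2D + 1 ≤ a, b, d` and brick 118's four margins (parameters `β₁, V₀, r₀, u`), every `0 ≤ ψ ≤ G`, `m ≥ 3`, and every
  `X ≥ (2√192·√(4(D+1)/V₀))^{2(D+1)} + 4^{D+1}·exp((u+u²)(t/2)a/(n/2−T−2) − u((t−T−2)/2+1−r₀))`:
  `|PM|·Σ_U W(U,M)·ψ(|U∩H|) ≤ B_v·C((T−1)/2,D+1)·G·ρ^{D+1}·X + 2^{D+1}·G·(D+1)·2(n/2+1)³·e^{−K²D}`.
READING: the untilted analogue of bricks 123–125; the asymptotic form and the average over `M` are brick 128b. WHAT THIS FILE DOES NOT DO: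
tilted masks (bricks 120–127), anything on `TracialDecayExp20` itself, psd rank of P_PM(K_n), or P vs NP.
[cite: Rothvoss2017, §2 (PDF p. 6)] [cite: RollinRoss2010, §3 Lemma 3.1, 3.3; §4.1 Thm 4.2] [cite: Agarwal2000DifferenceEquations, Remark 1.8.1 (1.8.8)]
Stature: support/instrument (kernel lane, no defs, axioms standard). Supports stmt-PneNP-19878.
-/

set_option linter.dupNamespace false -- `Summit.PneNP.PneNP.…`: summit = sub-problem (D-0017)

noncomputable section

namespace Summit.PneNP.PneNP.Theorems.ChebyshevTracialDesignBlockMaskBulk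

open Finset Polynomial Literature.Barriers.PneNP Literature.Combinatorics.Optimization
open Literature.Combinatorics.Optimization.ShellStep
open Summit.PneNP.PneNP.Theorems.ChebyshevTracialDesignBlockStatisticPricing (abs_designValue_blockStat_add_newton_le)
open Summit.PneNP.PneNP.Theorems.ChebyshevTracialDesignVirtualPositivityCriterion (shellProfile_newton_eval_zero_ge)
open Summit.PneNP.PneNP.Theorems.ChebyshevTracialDesignShellOperatorForm (shell_partner_nonempty)
open Summit.PneNP.PneNP.Theorems.ChebyshevTracialDesignBulkNumerics (bulk_numerics)
open Summit.PneNP.PneNP.Theorems.ChebyshevTracialDesignCrossingPlaneUnconditional (le_rpow_inv_eight window_centre)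
open Summit.PneNP.PneNP.Theorems.ChebyshevTracialDesignCrossingPlaneByType (smoothnessFamily_le_of_type)

variable {n : ℕ}

/-! ### §1 The untilted mask, conditional on [BULK] on a window -/

/-- **The plain block statistic at `e^{−a′D}` precision, conditional on [BULK] (brick 117 ∘ brick 121 ∘ ShellLawTail).** For an exact design
with `t = t₁ + 2(D+1) + 2`, a matching `M`, a block `H`, `0 ≤ ψ ≤ G` on `[0,t]`, `m ≥ 3` with `m + 4(D+1) ≤ n`, the order-`(D+1)` smoothness
number `X` of brick 117, `ε ≥ 0`, and relative level-smoothness at every `x ∈ [0,t]` with `|x − t|H|/n| < ε`: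
`|PM|·Σ_U W(U,M)·ψ(|U∩H|) ≤ B_v·C((T−1)/2,D+1)·G·ρ^{D+1}·X + 2^{D+1}·G·(D+1)·2(n/2+1)³·e^{−ε²/|H|}`.
[cite: Rothvoss2017, §2 (PDF p. 6)] [cite: Agarwal2000DifferenceEquations, Remark 1.8.1 (1.8.8)] -/
theorem blockMask_value_le_of_relSmooth_window {t₁ T D : ℕ} {Bv : ℝ} {C : Finset ℕ} {w : ℕ → ℝ}
    (hdes : IsExactDesign n (t₁ + 2 * (D + 1) + 2) T D Bv C w) (M : PMatch n) (H : Finset (Fin n)) (ψ : ℤ → ℝ)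
    {G : ℝ} (hG0 : 0 ≤ G) (hG : ∀ x ∈ Icc (0 : ℤ) ((t₁ + 2 * (D + 1) + 2 : ℕ) : ℤ), |ψ x| ≤ G)
    (hψ0 : ∀ x ∈ Icc (0 : ℤ) ((t₁ + 2 * (D + 1) + 2 : ℕ) : ℤ), 0 ≤ ψ x)
    {m : ℕ} (hm : 3 ≤ m) (hmn : m + 4 * (D + 1) ≤ n) {X : ℝ} (hX0 : 0 ≤ X)
    (hX : ∀ c : ℕ, Odd c → c + 2 * (D + 1) ≤ T → ∀ S' : Finset (Fin n), (∀ v ∈ S', M.2.partner v ∈ S') →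
      S'.card + 4 * (D + 1) = n →
      ∑ x ∈ Icc (0 : ℤ) ((t₁ + 2 * (D + 1) + 2 : ℕ) : ℤ),
        |nab2^[D + 1] (fun c' x => shellLaw M.2.partner S' H (t₁ + 2) c' x : Profile) c x| ≤ X)
    {ε : ℝ} (hε : 0 ≤ ε)
    (hbulk : ∀ x ∈ Icc (0 : ℤ) ((t₁ + 2 * (D + 1) + 2 : ℕ) : ℤ),
      |(x : ℝ) - ((t₁ + 2 * (D + 1) + 2 : ℕ) : ℝ) * H.card / n| < ε →
      ∑ k ∈ Ico 1 (D + 1), (((2 * k).choose k : ℕ) : ℝ) / (4 : ℝ) ^ k *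
        |(fwdDiff (1 : ℕ))^[k] (fun j => shellLaw M.2.partner univ H (t₁ + 2 * (D + 1) + 2) (2 * j + 1) x) 0| ≤
          shellLaw M.2.partner univ H (t₁ + 2 * (D + 1) + 2) 1 x) :
    (Fintype.card (PMatch n) : ℝ) * ∑ U : OddSet n, levelWeight n (t₁ + 2 * (D + 1) + 2) C w U M * ψ ((U.1 ∩ H).card : ℤ) ≤
      Bv * ((((T - 1) / 2).choose (D + 1) : ℕ) : ℝ) * (G * (((m : ℝ) / (4 * ((m : ℝ) - 2))) ^ (D + 1) * X)) +
        (2 : ℝ) ^ (D + 1) * G * (((D : ℝ) + 1) * (2 * ((n : ℝ) / 2 + 1) ^ 3 * Real.exp (-(ε ^ 2 / H.card)))) := by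
  have hπ : ∀ v, M.2.partner (M.2.partner v) = v := partner_partner M
  have hπ' : ∀ v, M.2.partner v ≠ v := partner_ne M
  have e : t₁ + 2 * (D + 1) + 2 = (t₁ + 2) + 2 * (D + 1) := by ring
  have hdes' : IsExactDesign n ((t₁ + 2) + 2 * (D + 1)) T D Bv C w := by rw [← e]; exact hdes
  have hG' : ∀ x ∈ Icc (0 : ℤ) (((t₁ + 2) + 2 * (D + 1) : ℕ) : ℤ), |ψ x| ≤ G := by rw [← e]; exact hG
  have hX' : ∀ c : ℕ, Odd c → c + 2 * (D + 1) ≤ T → ∀ S' : Finset (Fin n), (∀ v ∈ S', M.2.partner v ∈ S') →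
      S'.card + 4 * (D + 1) = n →
      ∑ x ∈ Icc (0 : ℤ) (((t₁ + 2) + 2 * (D + 1) : ℕ) : ℤ),
        |nab2^[D + 1] (fun c' x => shellLaw M.2.partner S' H (t₁ + 2) c' x : Profile) c x| ≤ X := by
    rw [← e]; exact hX
  have h117 := abs_designValue_blockStat_add_newton_le hdes' M H ψ hG0 hG' hm hmn hX0 hX'
  rw [← e] at h117
  have hPM : (0 : ℝ) < Fintype.card (PMatch n) := by
    have : 0 < Fintype.card (PMatch n) := Fintype.card_pos_iff.2 ⟨M⟩
    exact_mod_cast this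
  -- the window
  let B : Finset ℤ := (Icc (0 : ℤ) ((t₁ + 2 * (D + 1) + 2 : ℕ) : ℤ)).filter
    (fun x : ℤ => |(x : ℝ) - ((t₁ + 2 * (D + 1) + 2 : ℕ) : ℝ) * H.card / n| < ε)
  have hB : B ⊆ Icc (0 : ℤ) ((t₁ + 2 * (D + 1) + 2 : ℕ) : ℤ) := filter_subset _ _
  have hbulkB : ∀ x ∈ B, ∑ k ∈ Ico 1 (D + 1), (((2 * k).choose k : ℕ) : ℝ) / (4 : ℝ) ^ k *
      |(fwdDiff (1 : ℕ))^[k] (fun j => shellLaw M.2.partner univ H (t₁ + 2 * (D + 1) + 2) (2 * j + 1) x) 0| ≤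
        shellLaw M.2.partner univ H (t₁ + 2 * (D + 1) + 2) 1 x :=
    fun x hx => hbulk x (mem_filter.1 hx).1 (mem_filter.1 hx).2
  have hψG : ∀ x ∈ Icc (0 : ℤ) ((t₁ + 2 * (D + 1) + 2 : ℕ) : ℤ), ψ x ≤ G := fun x hx => (le_abs_self _).trans (hG x hx)
  have h121 := shellProfile_newton_eval_zero_ge (π := M.2.partner) D (t₁ + 2 * (D + 1) + 2) H ψ hψ0 hψG B hB hbulkB
  have htail := sum_sdiff_sum_levels_shellLaw_le hπ hπ' H (t₁ + 2 * (D + 1) + 2) D hε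
    (Icc (0 : ℤ) ((t₁ + 2 * (D + 1) + 2 : ℕ) : ℤ)) B (fun x hx => by
      have h := mem_sdiff.1 hx
      have : ¬ |(x : ℝ) - ((t₁ + 2 * (D + 1) + 2 : ℕ) : ℝ) * H.card / n| < ε :=
        fun hlt => h.2 (mem_filter.2 ⟨h.1, hlt⟩)
      exact not_lt.1 this)
  have hc : 0 ≤ (2 : ℝ) ^ (D + 1) * G := by positivity
  have hmul := mul_le_mul_of_nonneg_left htail hc
  -- `|PM|·(Σ W ψ) ≤ −N + Rem`
  have habs := (abs_le.1 h117).2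
  have hkey : (Fintype.card (PMatch n) : ℝ) * ∑ U : OddSet n,
      levelWeight n (t₁ + 2 * (D + 1) + 2) C w U M * ψ ((U.1 ∩ H).card : ℤ) ≤
      -(DesignRemainder.newtonPolyOdd D (fun c =>
          (∑ U' ∈ shell M.2.partner (t₁ + 2 * (D + 1) + 2) c, ψ ((U' ∩ H).card : ℤ)) /
            ((shell M.2.partner (t₁ + 2 * (D + 1) + 2) c).card : ℝ))).eval 0 +
        Bv * ((((T - 1) / 2).choose (D + 1) : ℕ) : ℝ) * (G * (((m : ℝ) / (4 * ((m : ℝ) - 2))) ^ (D + 1) * X)) := by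
    have h1 := mul_le_mul_of_nonneg_left habs hPM.le
    rw [mul_add (Fintype.card (PMatch n) : ℝ), mul_inv_cancel_left₀ hPM.ne', mul_inv_cancel_left₀ hPM.ne'] at h1
    linarith
  push_cast at h121 hkey hmul ⊢
  linarith [h121, hkey, hmul]

/-! ### §2 [BULK] and the smoothness number discharged -/

/-- **The untilted mask per non-aligned matching, [BULK] and `X` discharged (brick 128a §2).** For every `β > 0`, `K ≥ 0` there is
`n₀` such that for `n ≥ n₀`: for every balanced exact design (`t = t₁+2(D+1)+2`, `n ≤ 4t`, `2D+1 ≤ T`, `1 ≤ D`, `D⁴ ≤ n`), every `M, H`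
with `βn/2 + 2D + 1 ≤ a, b, d` and brick 118's four type margins (parameters `β₁ > 0`, `V₀ > 0` with `2(D+1)−1 ≤ 2V₀`, `u ∈ [0,1]`, `r₀`,
`T + 2 < n/2`), every `0 ≤ ψ ≤ G` on `[0,t]`, `m ≥ 3` with `m + 4(D+1) ≤ n`, and every
`X ≥ (2√192·√(4(D+1)/V₀))^{2(D+1)} + 4^{D+1}·exp((u+u²)(t/2)a/(n/2−T−2) − u((t−T−2)/2+1−r₀))`:
`|PM|·Σ_U W(U,M)·ψ(|U∩H|) ≤ B_v·C((T−1)/2,D+1)·G·ρ^{D+1}·X + 2^{D+1}·G·(D+1)·2(n/2+1)³·e^{−(K√(|H|D))²/|H|}`.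
[cite: Rothvoss2017, §2 (PDF p. 6)] [cite: RollinRoss2010, §3 Lemma 3.1, 3.3; §4.1 Thm 4.2] -/
theorem blockMask_value_le_of_type {β K : ℝ} (hβ : 0 < β) (hK : 0 ≤ K) :
    ∃ n₀ : ℕ, ∀ n : ℕ, n₀ ≤ n → ∀ {t₁ T D : ℕ} {Bv : ℝ} {C : Finset ℕ} {w : ℕ → ℝ},
    IsExactDesign n (t₁ + 2 * (D + 1) + 2) T D Bv C w → 2 * D + 1 ≤ T → n ≤ 4 * (t₁ + 2 * (D + 1) + 2) →
    1 ≤ D → D ^ 4 ≤ n → ∀ (M : PMatch n) (H : Finset (Fin n)),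
    β * n / 2 + 2 * D + 1 ≤ (reps M.2.partner (vAA M.2.partner univ H)).card →
    β * n / 2 + 2 * D + 1 ≤ (reps M.2.partner (vBH M.2.partner univ H ∪ vBN M.2.partner univ H)).card →
    β * n / 2 + 2 * D + 1 ≤ (reps M.2.partner (vDD M.2.partner univ H)).card →
    ∀ (ψ : ℤ → ℝ) {G : ℝ}, 0 ≤ G →
    (∀ x ∈ Icc (0 : ℤ) ((t₁ + 2 * (D + 1) + 2 : ℕ) : ℤ), |ψ x| ≤ G) →
    (∀ x ∈ Icc (0 : ℤ) ((t₁ + 2 * (D + 1) + 2 : ℕ) : ℤ), 0 ≤ ψ x) →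
    ∀ {m : ℕ}, 3 ≤ m → m + 4 * (D + 1) ≤ n →
    ∀ {β₁ V₀ u : ℝ} {r₀ : ℕ}, 0 < β₁ → 0 < V₀ → 0 ≤ u → u ≤ 1 → (2 * (D + 1 : ℕ) : ℝ) - 1 ≤ 2 * V₀ →
    β₁ * (((reps M.2.partner (vBH M.2.partner univ H ∪ vBN M.2.partner univ H)).card : ℝ) +
      (reps M.2.partner (vDD M.2.partner univ H)).card) + T + 2 * (D + 2) ≤
      (reps M.2.partner (vBH M.2.partner univ H ∪ vBN M.2.partner univ H)).card →
    β₁ * (((reps M.2.partner (vBH M.2.partner univ H ∪ vBN M.2.partner univ H)).card : ℝ) +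
      (reps M.2.partner (vDD M.2.partner univ H)).card) + T + 2 * (D + 2) ≤
      (reps M.2.partner (vDD M.2.partner univ H)).card →
    β₁ * (((reps M.2.partner (vBH M.2.partner univ H ∪ vBN M.2.partner univ H)).card : ℝ) +
      (reps M.2.partner (vDD M.2.partner univ H)).card) ≤ r₀ →
    ((t₁ + 2 * (D + 1) + 2 : ℕ) : ℝ) / 2 +
      β₁ * (((reps M.2.partner (vBH M.2.partner univ H ∪ vBN M.2.partner univ H)).card : ℝ) +
        (reps M.2.partner (vDD M.2.partner univ H)).card) + 2 * T + 4 * (D + 2) + 2 ≤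
      ((reps M.2.partner (vBH M.2.partner univ H ∪ vBN M.2.partner univ H)).card : ℝ) +
        (reps M.2.partner (vDD M.2.partner univ H)).card →
    V₀ ≤ β₁ ^ 4 * ((((reps M.2.partner (vBH M.2.partner univ H ∪ vBN M.2.partner univ H)).card : ℝ) +
      (reps M.2.partner (vDD M.2.partner univ H)).card) - 4 * (D + 2) - 2 * T) →
    (T : ℝ) + 2 < (n : ℝ) / 2 →
    ∀ (X : ℝ), (2 * Real.sqrt 192 * Real.sqrt (4 * (D + 1 : ℕ) / V₀)) ^ (2 * (D + 1)) +
        (4 : ℝ) ^ (D + 1) * Real.exp ((u + u ^ 2) * (((t₁ + 2 * (D + 1) + 2 : ℕ) : ℝ) / 2 *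
          (reps M.2.partner (vAA M.2.partner univ H)).card / ((n : ℝ) / 2 - T - 2)) -
          u * ((((t₁ + 2 * (D + 1) + 2 : ℕ) : ℝ) - T - 2) / 2 + 1 - r₀)) ≤ X →
    (Fintype.card (PMatch n) : ℝ) * ∑ U : OddSet n, levelWeight n (t₁ + 2 * (D + 1) + 2) C w U M * ψ ((U.1 ∩ H).card : ℤ) ≤
      Bv * ((((T - 1) / 2).choose (D + 1) : ℕ) : ℝ) * (G * (((m : ℝ) / (4 * ((m : ℝ) - 2))) ^ (D + 1) * X)) +
        (2 : ℝ) ^ (D + 1) * G * (((D : ℝ) + 1) * (2 * ((n : ℝ) / 2 + 1) ^ 3 *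
          Real.exp (-((K * Real.sqrt (H.card * D)) ^ 2 / H.card)))) := by
  -- the internal type margin `β₀ = min β (1/5)`
  obtain ⟨β₀, hβ₀⟩ : ∃ e : ℝ, e = min β (1 / 5) := ⟨_, rfl⟩
  have hβ₀pos : 0 < β₀ := by rw [hβ₀]; exact lt_min hβ (by norm_num)
  have hβ₀5 : β₀ ≤ 1 / 5 := by rw [hβ₀]; exact min_le_right _ _
  have hβ₀β : β₀ ≤ β := by rw [hβ₀]; exact min_le_left _ _
  -- the numeric threshold
  obtain ⟨Pstar, hPstar0, hnum⟩ := bulk_numerics (β := β₀) (K := K) (C₁ := 8) (C₂ := 10) (C₃ := 2048)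
    hβ₀pos hβ₀5 hK (by norm_num) (by norm_num) (by norm_num)
  refine ⟨⌈2 * Pstar ^ 8⌉₊ + 2, ?_⟩
  intro n hn t₁ T D Bv C w hdes hDT hbal hD1 hD4 M H haβ hbβ hdβ ψ G hG0 hG hψ0 m hm hmn β₁ V₀ u r₀ hβ₁ hV₀ hu0 hu1 hkV hbT hdT
    hr₀ hsT hV₀le hNT X hXge
  have hπ : ∀ v, M.2.partner (M.2.partner v) = v := partner_partner M
  have hπ' : ∀ v, M.2.partner v ≠ v := partner_ne M
  have hst : ∀ v ∈ (univ : Finset (Fin n)), M.2.partner v ∈ univ := fun v _ => mem_univ _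
  -- types of `univ`
  obtain ⟨a, ha⟩ : ∃ a : ℕ, (reps M.2.partner (vAA M.2.partner univ H)).card = a := ⟨_, rfl⟩
  obtain ⟨b, hb⟩ : ∃ b : ℕ, (reps M.2.partner (vBH M.2.partner univ H ∪ vBN M.2.partner univ H)).card = b :=
    ⟨_, rfl⟩
  obtain ⟨d, hd⟩ : ∃ d : ℕ, (reps M.2.partner (vDD M.2.partner univ H)).card = d := ⟨_, rfl⟩
  obtain ⟨N₀, hN⟩ : ∃ N₀ : ℕ, a + b + d = N₀ := ⟨_, rfl⟩
  have hn2 : n = 2 * N₀ := by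
    have h := two_mul_typeReps_eq_card hπ hπ' hst H
    rw [ha, hb, hd, card_univ, Fintype.card_fin] at h; omega
  rw [ha] at haβ; rw [hb] at hbβ; rw [hd] at hdβ
  have hnr : (n : ℝ) = 2 * N₀ := by exact_mod_cast hn2
  have hN₀r : (N₀ : ℝ) = (n : ℝ) / 2 := by rw [hnr]; ring
  -- design data: `t` odd, balanced
  obtain ⟨s, hs2⟩ : ∃ s : ℕ, t₁ + 2 * (D + 1) + 2 = 2 * s + 1 := hdes.1
  have htn : 2 * (t₁ + 2 * (D + 1) + 2) + 2 ≤ n := hdes.2.1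
  have hTt : T ≤ t₁ + 2 * (D + 1) + 2 := hdes.2.2.1
  -- the scale hypotheses of the numerics
  have hn0 : (⌈2 * Pstar ^ 8⌉₊ : ℝ) + 2 ≤ n := by exact_mod_cast hn
  have hceil := Nat.le_ceil (2 * Pstar ^ 8)
  have hN₀1 : (1 : ℝ) ≤ N₀ := by rw [hN₀r]; linarith
  have hPN : Pstar ≤ (N₀ : ℝ) ^ ((8 : ℕ) : ℝ)⁻¹ :=
    le_rpow_inv_eight hPstar0 (by rw [hN₀r]; linarith)
  have hD4r : ((D : ℝ)) ^ 4 ≤ 2 * N₀ := by rw [← hnr]; exact_mod_cast hD4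
  -- `|H| = 2a + b ≤ n`
  have hHcard : (H.card : ℝ) = 2 * a + b := by
    have := card_eq_two_mul_add_of_types hπ hπ' H
    rw [ha, hb] at this; exact_mod_cast this
  have hHn : (H.card : ℝ) ≤ n := by
    have h := card_le_univ H
    rw [Fintype.card_fin] at h
    exact_mod_cast h
  have hHpos : 0 < (H.card : ℝ) := by
    rw [hHcard]
    have : (0 : ℝ) ≤ a := Nat.cast_nonneg _
    have : (0 : ℝ) < b := by
      have : (0 : ℝ) < β * n / 2 + 2 * D + 1 := by positivity
      linarith
    linarith
  -- the window `ε = K√(|H|D)` (opaque name, definitional for the final `exact`)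
  obtain ⟨ε, hεdef⟩ : ∃ e : ℝ, e = K * Real.sqrt (H.card * D) := ⟨_, rfl⟩
  have hε0 : 0 ≤ ε := by rw [hεdef]; exact mul_nonneg hK (Real.sqrt_nonneg _)
  have hεK : ε ≤ K * Real.sqrt (2 * N₀ * D) := by
    rw [hεdef]
    refine mul_le_mul_of_nonneg_left (Real.sqrt_le_sqrt ?_) hK
    rw [← hnr]; exact mul_le_mul_of_nonneg_right hHn (Nat.cast_nonneg _)
  -- the numerics
  -- the numerics
  obtain ⟨E, hE⟩ : ∃ e : ℝ, e = 8 * (ε + 1 + 10) ^ 2 / (β₀ ^ 4 * ((N₀ : ℝ) - 1)) := ⟨_, rfl⟩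
  obtain ⟨R, hR⟩ : ∃ e : ℝ, e = E + Real.log (2 * 2048) + 2 * Real.log N₀ + D := ⟨_, rfl⟩
  obtain ⟨L, hL⟩ : ∃ e : ℝ, e = 2 * D + Real.sqrt (4 * N₀ * R) := ⟨_, rfl⟩
  obtain ⟨c1, c2, c3, c4, c5, c6, c7, c8, c9, c10, c11, c12, c13, -, c15, c16⟩ :=
    hnum N₀ hPN hN₀1 D hD1 hD4r ε hε0 hεK E R L hE hR hL
  -- margins in `β₀`
  have hβ₀N : β₀ * N₀ ≤ β * n / 2 := by
    rw [hN₀r]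
    have : β₀ * ((n : ℝ) / 2) ≤ β * ((n : ℝ) / 2) := mul_le_mul_of_nonneg_right hβ₀β (by positivity)
    linarith
  have haβ' : β₀ * N₀ + 1 ≤ a := by have : (0:ℝ) ≤ D := Nat.cast_nonneg _; linarith
  have hbβ' : β₀ * N₀ + 2 * D + 1 ≤ b := by linarith
  have hdβ' : β₀ * N₀ + 2 * D + 1 ≤ d := by linarith
  -- `s` is balanced
  have htr : ((t₁ + 2 * (D + 1) + 2 : ℕ) : ℝ) = 2 * s + 1 := by exact_mod_cast hs2
  have hbalr : (n : ℝ) ≤ 4 * (2 * s + 1) := by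
    have : (n : ℝ) ≤ 4 * ((t₁ + 2 * (D + 1) + 2 : ℕ) : ℝ) := by exact_mod_cast hbal
    rwa [htr] at this
  have htnr : 2 * (2 * (s : ℝ) + 1) + 2 ≤ n := by
    have : 2 * ((t₁ + 2 * (D + 1) + 2 : ℕ) : ℝ) + 2 ≤ n := by exact_mod_cast htn
    rwa [htr] at this
  have hs_lo : β₀ * N₀ + D ≤ s := by rw [hnr] at hbalr; linarith only [hbalr, c11]
  have hs_hi : 8 * (s : ℝ) ≤ (4 + β₀) * ((N₀ : ℝ) - 2 * D) := by rw [hnr] at htnr; linarith only [htnr, c12]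
  -- the smoothness number at order `D + 1`, by the type (brick 125)
  have htnT : (t₁ + 2 * (D + 1) + 2) + T + 2 ≤ n := by omega
  have hdis := smoothnessFamily_le_of_type M H (D := D) htnT hβ₁ hV₀ hu0 hu1 r₀ hkV hbT hdT hr₀ hsT hV₀le hNT
  have hX0 : 0 ≤ X := le_trans (by positivity) hXge
  have hX : ∀ c : ℕ, Odd c → c + 2 * (D + 1) ≤ T → ∀ S' : Finset (Fin n), (∀ v ∈ S', M.2.partner v ∈ S') →
      S'.card + 4 * (D + 1) = n →
      ∑ x ∈ Icc (0 : ℤ) ((t₁ + 2 * (D + 1) + 2 : ℕ) : ℤ),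
        |nab2^[D + 1] (fun c' x => shellLaw M.2.partner S' H (t₁ + 2) c' x : Profile) c x| ≤ X := by
    intro c _ hcT S' hS' hcard
    have h := hdis (D + 1) le_rfl 0 (by norm_num) c hcT S' hS' (by omega)
    have e1 : t₁ + 2 * (D + 1) + 2 - 0 - 2 * (D + 1) = t₁ + 2 := by omega
    have e2 : t₁ + 2 * (D + 1) + 2 - 0 = t₁ + 2 * (D + 1) + 2 := by omega
    rw [e1, e2] at h
    exact h.trans hXge
  -- apply §1 with `ε = K√(|H|D)`
  rw [← hεdef]
  refine blockMask_value_le_of_relSmooth_window hdes M H ψ hG0 hG hψ0 hm hmn hX0 hX hε0 ?_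
  -- [BULK] at every window point (as in brick 124)
  intro x hx hwin
  obtain ⟨hx0, hxt⟩ := mem_Icc.1 hx
  obtain ⟨x', rfl⟩ : ∃ x' : ℕ, x = (x' : ℤ) := ⟨x.toNat, (Int.toNat_of_nonneg hx0).symm⟩
  have hwin' : |(x' : ℝ) - (2 * (s : ℝ) + 1) * H.card / n| < ε := by
    rw [htr] at hwin; simpa using hwin
  have hN₀pos : (0 : ℝ) < N₀ := by linarith only [hN₀1]
  have hxwin : |(x' : ℝ) - (2 * (s : ℝ) + 1) * (2 * a + b) / (2 * N₀)| < ε := by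
    rw [← hHcard, ← hnr]; exact hwin'
  have hy : |(x' : ℝ) - s * (2 * a + b) / N₀| ≤ ε + 1 :=
    window_centre hN₀pos (by positivity) (by
      have h1 : ((a + b + d : ℕ) : ℝ) = N₀ := by rw [hN]
      push_cast at h1
      linarith only [h1, Nat.cast_nonneg (α := ℝ) d]) hxwin
  have hD0 : (0 : ℝ) ≤ D := Nat.cast_nonneg _
  have hs' : 8 * (s : ℝ) ≤ (4 + β₀) * N₀ := by
    have : 0 ≤ (4 + β₀) * (2 * (D : ℝ)) := mul_nonneg (by linarith only [hβ₀pos]) (by positivity)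
    linarith only [hs_hi, this]
  have hLB := shellLaw_one_window_lower hπ hπ' hst H ha hb hd hN hβ₀pos (by linarith only [hβ₀5]) haβ'
    (by linarith only [hbβ', hD0]) (by linarith only [hdβ', hD0]) (s := s) (by linarith only [hs_lo, hD0]) hs'
    hy c15 c16
  rw [show 1 + 2 * s = 2 * s + 1 by ring] at hLB
  have hxD : 2 * D ≤ x' := by
    have h1 : β₀ * N₀ / 4 ≤ (2 * (s : ℝ) + 1) * H.card / n := by
      rw [hnr, hHcard]
      rw [le_div_iff₀ (by positivity)]
      have hb0 : β₀ * N₀ ≤ 2 * (a : ℝ) + b := by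
        linarith only [hbβ', hD0, Nat.cast_nonneg (α := ℝ) a, mul_pos hβ₀pos hN₀pos]
      have hs0 : (N₀ : ℝ) / 2 ≤ 2 * s + 1 := by rw [hnr] at hbalr; linarith only [hbalr]
      have h3 := mul_le_mul hs0 hb0 (by positivity) (by positivity)
      have e : (N₀ : ℝ) / 2 * (β₀ * N₀) = β₀ * N₀ / 4 * (2 * N₀) := by ring
      linarith only [h3, e]
    have h2 := (abs_lt.1 hwin').1
    have h4 : (2 * D : ℝ) ≤ x' := by linarith only [h1, h2, c13]
    exact_mod_cast h4
  have hne : ∀ k, k ≤ D → (shellIn M.2.partner univ (2 * s + 1) (1 + 2 * k)).Nonempty := by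
    intro k hk
    rw [shellIn_univ, ← hs2]
    exact shell_partner_nonempty M hdes.1 ⟨k, by ring⟩ (by omega) (by omega)
  have c1' : 16 * D + 16 ≤ N₀ := by exact_mod_cast c1
  have h := relSmooth_of_hyps hπ hπ' H ha hb hd hN hn2 hβ₀pos (by linarith only [hβ₀5]) c1' hbβ' hdβ' hs_lo hs_hi
    hne hwin' hxD c2 c3 c4 c5 c6 c7 c8 c9 hLB (by rw [hE] at c10; exact c10)
  rw [hs2]
  exact h

end Summit.PneNP.PneNP.Theorems.ChebyshevTracialDesignBlockMaskBulk

end
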